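import Literature.Geometry.Lorentzian.NormalExpJacobi
import Literature.Geometry.Riemannian.ExpMapGlobalSmooth
import Literature.Geometry.Riemannian.MaximalGeodesicRescaling
import Literature.Geometry.Riemannian.GaussBonnetGradient
import Literature.Geometry.Lorentzian.DivergenceTheorem
import HarnessLib

/-!
# The Jacobi fields of the field-exponential map `x ↦ exp_x(t V(x))` in a parallel frame
# (Brendle 2023, proof of Prop. 2.5)

Topic `Geometry/Riemannian`. S. Brendle, *Sobolev inequalities in manifolds with nonnegative
curvature*, CPAM 76 (2023), §2, proof of Prop. 2.5: for the ABP map `Φ_t(x) = exp_x(t ∇u(x))` and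
a point `x̄`, "we denote by `X_i(t)` the unique Jacobi field along `γ̄(t) = exp_x̄(t∇u(x̄))`
satisfying `X_i(0) = e_i` and `⟨D_t X_i(0), e_j⟩ = (D²u)(e_i, e_j)` … `∂Φ_t/∂x_i (x̄) = X_i(t)`",
and in the parallel orthonormal frame `E_j(t)` the matrix `P_{ij}(t) = ⟨X_i(t), E_j(t)⟩` satisfies
`P'' = -PS`, `P(0) = δ`, `P'(0) = (D²u)(e_i, e_j)`, `S` symmetric with `tr S = Ric(γ̄', γ̄') ≥ 0`,
and `|det DΦ_t(x̄)| = det P(t)`.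

This file proves these statements for an ARBITRARY `C^∞` vector field `V` in place of `∇u`
(complete Levi-Civita connection, any boundaryless model), in the column convention of the tree's
matrix Jacobi/Riccati layer (`A = Pᵀ`, `A'' = -R A`, `VolumeSphereTheoremProofs.lean` §8,
`ABPJacobianComparison.lean`, `ABPNoConjugate.lean`):

* `jacobi_mfderiv_expMap_field(_curve/_of_curve)` — for `w ∈ T_pM` the field
  `𝒥_w(t) = d(Φ_t)_p(w)`, `Φ_t = (z ↦ exp_z(t V z))`, along `γ(t) = exp_p(t V p)` satisfies the
  Jacobi equation, has differentiable lifts, and `D_t 𝒥_w(0) = ∇_w V` — it is the variation field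
  of `(t, s) ↦ exp_{c(s)}(t V(c s))` for a curve `c` through `p` with velocity `w`
  (`Literature.Geometry.Lorentzian.normalExpVariation_jacobi` with `ι = id`, and
  `velocity_normalExpVariation_eq_mfderiv`, `covariantDerivAlong_normalExpVariation_zero`,
  `covariantDerivAlong_comp_holds`); `mfderiv_expMap_field_zero`: `𝒥_w(0) = w`;
  `contMDiff_lift_mfderiv_expMap_field`: the lift of `𝒥_w` is `C^∞`;
* `isJacobiFieldAlongOn_mfderiv_expMap_field` — the same for the Levi-Civita connection of a
  metric `g` (`IsJacobiFieldAlongOn`);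
* `hasDerivAt_frameMatrix_mfderiv_expMap_field` — **`A' = A₁`, `A₁' = -R A`** on the parameter
  set of a parallel `g`-orthonormal frame `e` (`A = (g(𝒥_{w_k}, e_i))`,
  `A₁ = (g(D_t 𝒥_{w_k}, e_i))`,
  `R` the frame curvature matrix; `hasDerivAt_frameMatrix_of_isJacobiFieldAlongOn`);
* `frameMatrix_mfderiv_expMap_field_zero` — **`A(0) = 1`, `A₁(0) = (g(∇_{w_k}V, w_i))`** for the
  frame through the orthonormal basis `w` of `T_pM`;
* `mfderiv_expMap_field_eq_sum_frame` — `d(Φ_t)_p(w_k) = ∑ᵢ A_{ik}(t) e_i(t)` and the Gram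
  determinant `det (g(dΦ_t w_k, dΦ_t w_l)) = det A(t)²` (`gram_eq_transpose_mul_of_orthonormal`),
  i.e. `|det DΦ_t(p)| = |det A(t)|` in orthonormal frames;
* `frameMatrix_leviCivita_grad` — for `V = grad u`: `(g(∇_{w_k}V, w_i)) = (Hess u(w_k, w_i))`,
  symmetric, with trace `Δ_g u` (`val_leviCivita_sharp_mvfderiv`, `hessian_symm_holds`,
  `trace_eq_sum_bilin_of_orthonormal`).

With `R` symmetric of trace `Ric(γ̄', γ̄')` (`isSymm_frameMatrix_curvature`,
`trace_frameMatrix_curvature`) these are exactly the hypotheses `hA, hA', hR, hA0, hA'0, hH` of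
`Literature.Geometry.Riemannian.antitoneOn_det_div_pow_of_hessian` /
`isUnit_det_jacobi_of_secondVariation` (bricks R1, R4 of the geometric half of the ABP proof
behind `Literature.Geometry.Riemannian.sharpLogSobolevAVR_four`). No definitions, no named
facts.

## References

* [Brendle2022] S. Brendle, CPAM 76 (2023) 2192–2218 (arXiv:2009.13717), §2, Prop. 2.5 and its
  proof (p. 6 of the arXiv text). READ.
* B. O'Neill, *Semi-Riemannian geometry* (1983), Ch. 8, Lemma 3; Ch. 10, Cor. 40.
  [ONeillSemiRiemannian1983]
-/

noncomputable section

open Bundle Set Filter Function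
open scoped Manifold ContDiff Topology Matrix

namespace Literature.Geometry.Riemannian

open Literature.Geometry.Lorentzian

section FieldJacobi

variable {E : Type*} [NormedAddCommGroup E] [NormedSpace ℝ E] [FiniteDimensional ℝ E]
  [CompleteSpace E] {H : Type*} [TopologicalSpace H] {I : ModelWithCorners ℝ E H}
  {M : Type*} [TopologicalSpace M] [ChartedSpace H M] [IsManifold I ∞ M] [T2Space M]
  [BoundarylessManifold I M]
  {cov : CovariantDerivative I E (TangentSpace I : M → Type _)}
  [CovariantDerivative.ContMDiffCovariantDerivative cov 1]
  [CovariantDerivative.ContMDiffCovariantDerivative cov (⊤ : ℕ∞)]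
  {V : Π x : M, TangentSpace I x}

/-- **The Jacobi field `d(Φ_t)(c'(0))` of the field-exponential map over a curve** (Brendle 2023,
proof of Prop. 2.5: "`∂Φ_t/∂x_i (x̄) = X_i(t)`", `X_i` Jacobi with `X_i(0) = e_i`,
`D_t X_i(0) = ∇_{e_i} V`). For a `C^∞` vector field `V`, a complete torsion-free locally `C¹`
connection and a `C^∞` curve `c`, the field `t ↦ d(z ↦ exp_z(t V z))_{c 0}(c'(0))` along
`t ↦ exp_{c 0}(t V(c 0))` satisfies the Jacobi equation at every `t₀`, its lift and the lift of its
covariant derivative are differentiable, and its initial covariant derivative is `∇_{c'(0)} V`: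
it is the variation field of `(t, s) ↦ exp_{c s}(t V(c s))` (`normalExpVariation_jacobi` with
`ι = id`, `velocity_normalExpVariation_eq_mfderiv`, `covariantDerivAlong_normalExpVariation_zero`,
`covariantDerivAlong_comp_holds`). [cite: Brendle2022, Prop. 2.5 (proof)] -/
theorem jacobi_mfderiv_expMap_field_curve (hcov₁ : cov.IsLocallyContMDiff 1)
    (htors : cov.torsion = 0) (hc : IsGeodesicallyComplete cov)
    (hV : ContMDiff I I.tangent ∞ (fun z ↦ (TotalSpace.mk' E z (V z) : TangentBundle I M)))
    {c : ℝ → M} (hcs : ContMDiff 𝓘(ℝ, ℝ) I ∞ c) (t₀ : ℝ) :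
    (covariantDerivAlong cov (fun t : ℝ ↦ expMap cov (c 0) (t • V (c 0)))
        (fun t : ℝ ↦ covariantDerivAlong cov (fun t : ℝ ↦ expMap cov (c 0) (t • V (c 0)))
          (fun t : ℝ ↦ mfderiv I I (fun z ↦ expMap cov z (t • V z)) (c 0) (velocity I c 0)) t) t₀ +
      cov.curvature (expMap cov (c 0) (t₀ • V (c 0)))
        (mfderiv I I (fun z ↦ expMap cov z (t₀ • V z)) (c 0) (velocity I c 0))
        (velocity I (fun t : ℝ ↦ expMap cov (c 0) (t • V (c 0))) t₀)
        (velocity I (fun t : ℝ ↦ expMap cov (c 0) (t • V (c 0))) t₀) = 0) ∧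
    MDifferentiableAt 𝓘(ℝ, ℝ) I.tangent (fun t : ℝ ↦ (TotalSpace.mk' E
        (expMap cov (c 0) (t • V (c 0)))
        (mfderiv I I (fun z ↦ expMap cov z (t • V z)) (c 0) (velocity I c 0)) :
          TangentBundle I M)) t₀ ∧
    MDifferentiableAt 𝓘(ℝ, ℝ) I.tangent (fun t : ℝ ↦ (TotalSpace.mk' E
        (expMap cov (c 0) (t • V (c 0)))
        (covariantDerivAlong cov (fun t : ℝ ↦ expMap cov (c 0) (t • V (c 0)))
          (fun t : ℝ ↦ mfderiv I I (fun z ↦ expMap cov z (t • V z)) (c 0) (velocity I c 0)) t) :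
          TangentBundle I M)) t₀ ∧
    covariantDerivAlong cov (fun t : ℝ ↦ expMap cov (c 0) (t • V (c 0)))
        (fun t : ℝ ↦ mfderiv I I (fun z ↦ expMap cov z (t • V z)) (c 0) (velocity I c 0)) 0 =
      cov V (c 0) (velocity I c 0) := by
  -- every parameter is in the domain (completeness)
  have hdom : ∀ (z : M) (t : ℝ), t ∈ maximalGeodesicDomain cov z (V z) := fun z t ↦ by
    rw [(maximalGeodesic_of_isGeodesicallyComplete hc z (V z)).1]; exact mem_univ t
  have hcev : ∀ s₀ : ℝ, ∀ᶠ s in 𝓝 s₀, ContMDiffAt 𝓘(ℝ, ℝ) I ∞ c s :=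
    fun s₀ ↦ Eventually.of_forall fun s : ℝ ↦ hcs s
  -- the velocity form of the field equals the `mfderiv` form at every parameter
  have hJ : ∀ t, velocity I (fun s : ℝ ↦ expMap cov (c s) (t • V (c s))) 0 =
      mfderiv I I (fun z ↦ expMap cov z (t • V z)) (c 0) (velocity I c 0) := fun t ↦
    velocity_normalExpVariation_eq_mfderiv (cov := cov) (ι := fun z : M ↦ z) (ν := V) hV
      ((hcs 0).mdifferentiableAt (by simp)) (hdom (c 0) t)
  have hJfun : (fun t : ℝ ↦ velocity I (fun s : ℝ ↦ expMap cov (c s) (t • V (c s))) 0) =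
      fun t : ℝ ↦ mfderiv I I (fun z ↦ expMap cov z (t • V z)) (c 0) (velocity I c 0) :=
    funext hJ
  obtain ⟨h1, -, h3, h4⟩ := normalExpVariation_jacobi (cov := cov) (ι := fun z : M ↦ z) (ν := V)
    hcov₁ htors hV (hcev 0) (hdom (c 0) t₀)
  rw [hJfun] at h1 h4
  rw [hJ t₀] at h1
  have h3' : MDifferentiableAt 𝓘(ℝ, ℝ) I.tangent (fun t : ℝ ↦ (TotalSpace.mk' E
      (expMap cov (c 0) (t • V (c 0)))
      (mfderiv I I (fun z ↦ expMap cov z (t • V z)) (c 0) (velocity I c 0)) :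
        TangentBundle I M)) t₀ := by
    refine h3.congr_of_eventuallyEq (Eventually.of_forall fun t : ℝ ↦ ?_)
    show (TotalSpace.mk' E (expMap cov (c 0) (t • V (c 0)))
        (mfderiv I I (fun z ↦ expMap cov z (t • V z)) (c 0) (velocity I c 0)) :
          TangentBundle I M) =
      TotalSpace.mk' E (expMap cov (c 0) (t • V (c 0)))
        (velocity I (fun s : ℝ ↦ expMap cov (c s) (t • V (c s))) 0)
    rw [hJ t]
    rfl
  refine ⟨h1, h3', h4, ?_⟩
  -- the initial derivative: symmetry lemma at `0` and `D_s T(0, 0) = D_s (V ∘ c)(0) = ∇_{c'} V`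
  obtain ⟨-, h2₀, -, -⟩ := normalExpVariation_jacobi (cov := cov) (ι := fun z : M ↦ z) (ν := V)
    hcov₁ htors hV (hcev 0) (hdom (c 0) 0)
  rw [hJfun] at h2₀
  have h5 := covariantDerivAlong_normalExpVariation_zero (cov := cov) (ι := fun z : M ↦ z)
    (ν := V) c 0
  beta_reduce at h5
  have h6 : covariantDerivAlong cov c (fun s : ℝ ↦ V (c s)) 0 = cov V (c 0) (velocity I c 0) :=
    covariantDerivAlong_comp_holds cov ((hcs 0).mdifferentiableAt (by simp))
      ((hV (c 0)).mdifferentiableAt (by simp))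
  exact h2₀.trans (h5.trans h6)


/-- `jacobi_mfderiv_expMap_field_curve` read at a prescribed point `p = c 0` and vector
`w = c'(0)` (substitution). [cite: Brendle2022, Prop. 2.5 (proof)] -/
theorem jacobi_mfderiv_expMap_field_of_curve (hcov₁ : cov.IsLocallyContMDiff 1)
    (htors : cov.torsion = 0) (hc : IsGeodesicallyComplete cov)
    (hV : ContMDiff I I.tangent ∞ (fun z ↦ (TotalSpace.mk' E z (V z) : TangentBundle I M)))
    (p : M) (w : TangentSpace I p) {c : ℝ → M} (hcs : ContMDiff 𝓘(ℝ, ℝ) I ∞ c) (hp : c 0 = p)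
    (hw : velocity I c 0 = w) (t₀ : ℝ) :
    (covariantDerivAlong cov (fun t : ℝ ↦ expMap cov p (t • V p))
        (fun t : ℝ ↦ covariantDerivAlong cov (fun t : ℝ ↦ expMap cov p (t • V p))
          (fun t : ℝ ↦ mfderiv I I (fun z ↦ expMap cov z (t • V z)) p w) t) t₀ +
      cov.curvature (expMap cov p (t₀ • V p))
        (mfderiv I I (fun z ↦ expMap cov z (t₀ • V z)) p w)
        (velocity I (fun t : ℝ ↦ expMap cov p (t • V p)) t₀)
        (velocity I (fun t : ℝ ↦ expMap cov p (t • V p)) t₀) = 0) ∧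
    MDifferentiableAt 𝓘(ℝ, ℝ) I.tangent (fun t : ℝ ↦ (TotalSpace.mk' E
        (expMap cov p (t • V p))
        (mfderiv I I (fun z ↦ expMap cov z (t • V z)) p w) : TangentBundle I M)) t₀ ∧
    MDifferentiableAt 𝓘(ℝ, ℝ) I.tangent (fun t : ℝ ↦ (TotalSpace.mk' E
        (expMap cov p (t • V p))
        (covariantDerivAlong cov (fun t : ℝ ↦ expMap cov p (t • V p))
          (fun t : ℝ ↦ mfderiv I I (fun z ↦ expMap cov z (t • V z)) p w) t) :
          TangentBundle I M)) t₀ ∧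
    covariantDerivAlong cov (fun t : ℝ ↦ expMap cov p (t • V p))
        (fun t : ℝ ↦ mfderiv I I (fun z ↦ expMap cov z (t • V z)) p w) 0 = cov V p w := by
  subst hp
  subst hw
  exact jacobi_mfderiv_expMap_field_curve hcov₁ htors hc hV hcs t₀

/-- **The Jacobi field `𝒥_w(t) = d(Φ_t)_p(w)` of the field-exponential map**
(`Φ_t(z) = exp_z(t V z)`) along `γ(t) = exp_p(t V p)`: Jacobi equation at every `t₀`,
differentiable lifts of `𝒥_w` and `D_t 𝒥_w`, and `D_t 𝒥_w(0) = ∇_w V` (the curve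
`s ↦ exp_p(s w)` through `p` with velocity `w` in `jacobi_mfderiv_expMap_field_of_curve`).
Brendle 2023, proof of Prop. 2.5 (`X_i(0) = e_i`, `⟨D_t X_i(0), e_j⟩ = D²u(e_i, e_j)` for
`V = ∇u`). [cite: Brendle2022, Prop. 2.5 (proof)] -/
theorem jacobi_mfderiv_expMap_field (hcov₁ : cov.IsLocallyContMDiff 1)
    (htors : cov.torsion = 0) (hc : IsGeodesicallyComplete cov)
    (hV : ContMDiff I I.tangent ∞ (fun z ↦ (TotalSpace.mk' E z (V z) : TangentBundle I M)))
    (p : M) (w : TangentSpace I p) (t₀ : ℝ) :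
    (covariantDerivAlong cov (fun t : ℝ ↦ expMap cov p (t • V p))
        (fun t : ℝ ↦ covariantDerivAlong cov (fun t : ℝ ↦ expMap cov p (t • V p))
          (fun t : ℝ ↦ mfderiv I I (fun z ↦ expMap cov z (t • V z)) p w) t) t₀ +
      cov.curvature (expMap cov p (t₀ • V p))
        (mfderiv I I (fun z ↦ expMap cov z (t₀ • V z)) p w)
        (velocity I (fun t : ℝ ↦ expMap cov p (t • V p)) t₀)
        (velocity I (fun t : ℝ ↦ expMap cov p (t • V p)) t₀) = 0) ∧
    MDifferentiableAt 𝓘(ℝ, ℝ) I.tangent (fun t : ℝ ↦ (TotalSpace.mk' E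
        (expMap cov p (t • V p))
        (mfderiv I I (fun z ↦ expMap cov z (t • V z)) p w) : TangentBundle I M)) t₀ ∧
    MDifferentiableAt 𝓘(ℝ, ℝ) I.tangent (fun t : ℝ ↦ (TotalSpace.mk' E
        (expMap cov p (t • V p))
        (covariantDerivAlong cov (fun t : ℝ ↦ expMap cov p (t • V p))
          (fun t : ℝ ↦ mfderiv I I (fun z ↦ expMap cov z (t • V z)) p w) t) :
          TangentBundle I M)) t₀ ∧
    covariantDerivAlong cov (fun t : ℝ ↦ expMap cov p (t • V p))
        (fun t : ℝ ↦ mfderiv I I (fun z ↦ expMap cov z (t • V z)) p w) 0 = cov V p w := by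
  have hcs : ContMDiff 𝓘(ℝ, ℝ) I ∞ (fun s : ℝ ↦ expMap cov p (s • w)) :=
    (contMDiff_expMap_of_isGeodesicallyComplete (cov := cov) (k := (⊤ : ℕ∞)) le_top hc p).comp
      ((contDiff_id.smul contDiff_const).contMDiff)
  have hp : (fun s : ℝ ↦ expMap cov p (s • w)) 0 = p := by
    show expMap cov p ((0 : ℝ) • w) = p
    rw [zero_smul, expMap_zero]
  have hw : velocity I (fun s : ℝ ↦ expMap cov p (s • w)) 0 = w := velocity_expMap_smul_zero p w
  exact jacobi_mfderiv_expMap_field_of_curve hcov₁ htors hc hV p w hcs hp hw t₀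

/-- **The lift of `t ↦ d(Φ_t)_{c 0}(c'(0))` to `TM` is `C^∞`**: it is the partial velocity of
the `C^∞` two-parameter map `(t, s) ↦ exp_{c s}(t V(c s))`
(`contMDiff_lift_velocity_curry_right`). [folklore] -/
theorem contMDiff_lift_mfderiv_expMap_field_curve (hc : IsGeodesicallyComplete cov)
    (hV : ContMDiff I I.tangent ∞ (fun z ↦ (TotalSpace.mk' E z (V z) : TangentBundle I M)))
    {c : ℝ → M} (hcs : ContMDiff 𝓘(ℝ, ℝ) I ∞ c) :
    ContMDiff 𝓘(ℝ, ℝ) I.tangent ∞ (fun t : ℝ ↦ (TotalSpace.mk' E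
      (expMap cov (c 0) (t • V (c 0)))
      (mfderiv I I (fun z ↦ expMap cov z (t • V z)) (c 0) (velocity I c 0)) :
        TangentBundle I M)) := by
  have hdom : ∀ (z : M) (t : ℝ), t ∈ maximalGeodesicDomain cov z (V z) := fun z t ↦ by
    rw [(maximalGeodesic_of_isGeodesicallyComplete hc z (V z)).1]; exact mem_univ t
  have hcev : ∀ s₀ : ℝ, ∀ᶠ s in 𝓝 s₀, ContMDiffAt 𝓘(ℝ, ℝ) I ∞ c s :=
    fun s₀ ↦ Eventually.of_forall fun s ↦ hcs s
  have hx : ContMDiff (𝓘(ℝ, ℝ).prod 𝓘(ℝ, ℝ)) I ∞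
      (uncurry fun (t : ℝ) (s : ℝ) ↦ expMap cov (c s) (t • V (c s))) := fun q ↦
    (eventually_contMDiffAt_uncurry_normalExpVariation (cov := cov) (ι := fun z : M ↦ z) (ν := V)
      hV (hcev q.2) (hdom (c q.2) q.1)).self_of_nhds
  have h := contMDiff_lift_velocity_curry_right (I := I) hx 0
  have hJ : ∀ t, velocity I (fun s : ℝ ↦ expMap cov (c s) (t • V (c s))) 0 =
      mfderiv I I (fun z ↦ expMap cov z (t • V z)) (c 0) (velocity I c 0) := fun t ↦
    velocity_normalExpVariation_eq_mfderiv (cov := cov) (ι := fun z : M ↦ z) (ν := V) hV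
      ((hcs 0).mdifferentiableAt (by simp)) (hdom (c 0) t)
  refine h.congr fun t ↦ ?_
  show (TotalSpace.mk' E (expMap cov (c 0) (t • V (c 0)))
      (mfderiv I I (fun z ↦ expMap cov z (t • V z)) (c 0) (velocity I c 0)) : TangentBundle I M) =
    TotalSpace.mk' E (expMap cov (c 0) (t • V (c 0)))
      (velocity I (fun s : ℝ ↦ expMap cov (c s) (t • V (c s))) 0)
  rw [hJ t]
  rfl

/-- **The lift of `𝒥_w(t) = d(Φ_t)_p(w)` to `TM` is `C^∞` in `t`.** [folklore] -/
theorem contMDiff_lift_mfderiv_expMap_field (hc : IsGeodesicallyComplete cov)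
    (hV : ContMDiff I I.tangent ∞ (fun z ↦ (TotalSpace.mk' E z (V z) : TangentBundle I M)))
    (p : M) (w : TangentSpace I p) :
    ContMDiff 𝓘(ℝ, ℝ) I.tangent ∞ (fun t : ℝ ↦ (TotalSpace.mk' E (expMap cov p (t • V p))
      (mfderiv I I (fun z ↦ expMap cov z (t • V z)) p w) : TangentBundle I M)) := by
  have key : ∀ (q : M) (v : TangentSpace I q) (c : ℝ → M), ContMDiff 𝓘(ℝ, ℝ) I ∞ c → c 0 = q →
      velocity I c 0 = v → ContMDiff 𝓘(ℝ, ℝ) I.tangent ∞ (fun t : ℝ ↦ (TotalSpace.mk' E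
        (expMap cov q (t • V q)) (mfderiv I I (fun z ↦ expMap cov z (t • V z)) q v) :
          TangentBundle I M)) := by
    intro q v c hcs hq hv
    subst hq
    subst hv
    exact contMDiff_lift_mfderiv_expMap_field_curve hc hV hcs
  have hcs : ContMDiff 𝓘(ℝ, ℝ) I ∞ (fun s : ℝ ↦ expMap cov p (s • w)) :=
    (contMDiff_expMap_of_isGeodesicallyComplete (cov := cov) (k := (⊤ : ℕ∞)) le_top hc p).comp
      ((contDiff_id.smul contDiff_const).contMDiff)
  have hp : (fun s : ℝ ↦ expMap cov p (s • w)) 0 = p := by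
    show expMap cov p ((0 : ℝ) • w) = p
    rw [zero_smul, expMap_zero]
  exact key p w _ hcs hp (velocity_expMap_smul_zero p w)

omit [CovariantDerivative.ContMDiffCovariantDerivative cov (⊤ : ℕ∞)] in
/-- **`𝒥_w(0) = w`**: `Φ_0 = id` (`exp_z(0) = z`). [folklore] -/
theorem mfderiv_expMap_field_zero (p : M) (w : TangentSpace I p) :
    mfderiv I I (fun z ↦ expMap cov z ((0 : ℝ) • V z)) p w = w := by
  have h : (fun z ↦ expMap cov z ((0 : ℝ) • V z)) = id := by
    funext z
    rw [zero_smul, expMap_zero]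
    rfl
  rw [h, mfderiv_id]
  rfl

end FieldJacobi

/-! ### Metric form: Jacobi fields, frame matrices -/

section Metric

variable {E : Type*} [NormedAddCommGroup E] [NormedSpace ℝ E] [FiniteDimensional ℝ E]
  [CompleteSpace E] {H : Type*} [TopologicalSpace H] {I : ModelWithCorners ℝ E H}
  {M : Type*} [TopologicalSpace M] [ChartedSpace H M] [IsManifold I ∞ M] [T2Space M]
  [I.Boundaryless] {n : ℕ∞ω} [Fact (1 ≤ n)]
  (g : PseudoRiemannianMetric I n E (TangentSpace I : M → Type _)) [g.HasLeviCivita]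
  [CovariantDerivative.ContMDiffCovariantDerivative g.leviCivita 1]
  [CovariantDerivative.ContMDiffCovariantDerivative g.leviCivita ∞]
  {V : Π x : M, TangentSpace I x}

/-- **Metric form**: for the Levi-Civita connection of `g` (complete, locally `C¹`) the field
`𝒥_w(t) = d(Φ_t)_p(w)` is a Jacobi field along `γ(t) = exp_p(t V p)` on all of `ℝ`
(`IsJacobiFieldAlongOn`), with differentiable lifts of `𝒥_w`, `D_t 𝒥_w` and `D_t 𝒥_w(0) = ∇_w V`.
[cite: Brendle2022, Prop. 2.5 (proof)] -/
theorem isJacobiFieldAlongOn_mfderiv_expMap_field (hreg : g.leviCivita.IsLocallyContMDiff 1)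
    (hc : IsGeodesicallyComplete g.leviCivita)
    (hV : ContMDiff I I.tangent ∞ (fun z ↦ (TotalSpace.mk' E z (V z) : TangentBundle I M)))
    (p : M) (w : TangentSpace I p) :
    IsJacobiFieldAlongOn g (fun t : ℝ ↦ expMap g.leviCivita p (t • V p))
        (fun t : ℝ ↦ mfderiv I I (fun z ↦ expMap g.leviCivita z (t • V z)) p w) univ ∧
      (∀ t : ℝ, MDifferentiableAt 𝓘(ℝ, ℝ) I.tangent (fun t : ℝ ↦ (TotalSpace.mk' E
        (expMap g.leviCivita p (t • V p))
        (mfderiv I I (fun z ↦ expMap g.leviCivita z (t • V z)) p w) : TangentBundle I M)) t) ∧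
      (∀ t : ℝ, MDifferentiableAt 𝓘(ℝ, ℝ) I.tangent (fun t : ℝ ↦ (TotalSpace.mk' E
        (expMap g.leviCivita p (t • V p))
        (covariantDerivAlong g.leviCivita (fun t : ℝ ↦ expMap g.leviCivita p (t • V p))
          (fun t : ℝ ↦ mfderiv I I (fun z ↦ expMap g.leviCivita z (t • V z)) p w) t) :
          TangentBundle I M)) t) ∧
      covariantDerivAlong g.leviCivita (fun t : ℝ ↦ expMap g.leviCivita p (t • V p))
        (fun t : ℝ ↦ mfderiv I I (fun z ↦ expMap g.leviCivita z (t • V z)) p w) 0 =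
        g.leviCivita V p w := by
  have hLC := PseudoRiemannianMetric.isLeviCivita_leviCivita_holds (g := g)
  have h := fun t₀ ↦ jacobi_mfderiv_expMap_field (cov := g.leviCivita) hreg hLC.1 hc hV p w t₀
  exact ⟨fun t _ ↦ (h t).1, fun t : ℝ ↦ (h t).2.1, fun t : ℝ ↦ (h t).2.2.1, (h 0).2.2.2⟩

set_option maxHeartbeats 800000 in
/-- **The matrix Jacobi equation for `dΦ_t` in a parallel orthonormal frame** (Brendle 2023,
proof of Prop. 2.5: `P'' = -PS`; here in the column convention `A = Pᵀ`): for a frame `e` along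
`γ(t) = exp_p(t V p)`, parallel and `g`-orthonormal on `s` with `card ι = dim M`, and vectors
`w_k ∈ T_pM`, the matrices `A(t) = (g(d(Φ_t)_p w_k, e_i(t)))`,
`A₁(t) = (g(D_t d(Φ_t)_p w_k, e_i(t)))`
and the frame curvature matrix `R(t) = (g(R(e_j, γ̇)γ̇, e_i))` satisfy `A' = A₁`, `A₁' = -R A` at
every `t ∈ s` (`hasDerivAt_frameMatrix_of_isJacobiFieldAlongOn`).
[cite: Brendle2022, Prop. 2.5 (proof)] -/
theorem hasDerivAt_frameMatrix_mfderiv_expMap_field (hreg : g.leviCivita.IsLocallyContMDiff 1)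
    (hc : IsGeodesicallyComplete g.leviCivita)
    (hV : ContMDiff I I.tangent ∞ (fun z ↦ (TotalSpace.mk' E z (V z) : TangentBundle I M)))
    (p : M) {ι : Type*} [Fintype ι] [DecidableEq ι] {s : Set ℝ}
    {e : ι → Π t : ℝ, TangentSpace I (expMap g.leviCivita p (t • V p))}
    (he : ∀ i, IsParallelAlongOn g.leviCivita (fun t : ℝ ↦ expMap g.leviCivita p (t • V p)) (e i) s)
    (hon : ∀ t ∈ s, ∀ i j, g.val (expMap g.leviCivita p (t • V p)) (e i t) (e j t) =
      if i = j then 1 else 0)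
    (hcard : Fintype.card ι = Module.finrank ℝ E) (w : ι → TangentSpace I p) {t : ℝ}
    (ht : t ∈ s) :
    HasDerivAt (fun t : ℝ ↦ Matrix.of fun i k ↦ g.val (expMap g.leviCivita p (t • V p))
        (mfderiv I I (fun z ↦ expMap g.leviCivita z (t • V z)) p (w k)) (e i t))
      (Matrix.of fun i k ↦ g.val (expMap g.leviCivita p (t • V p))
        (covariantDerivAlong g.leviCivita (fun t : ℝ ↦ expMap g.leviCivita p (t • V p))
          (fun t : ℝ ↦ mfderiv I I (fun z ↦ expMap g.leviCivita z (t • V z)) p (w k)) t)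
        (e i t)) t ∧
    HasDerivAt (fun t : ℝ ↦ Matrix.of fun i k ↦ g.val (expMap g.leviCivita p (t • V p))
        (covariantDerivAlong g.leviCivita (fun t : ℝ ↦ expMap g.leviCivita p (t • V p))
          (fun t : ℝ ↦ mfderiv I I (fun z ↦ expMap g.leviCivita z (t • V z)) p (w k)) t) (e i t))
      (-((Matrix.of fun i j ↦ g.val (expMap g.leviCivita p (t • V p))
          (g.leviCivita.curvature (expMap g.leviCivita p (t • V p)) (e j t)
            (velocity I (fun t : ℝ ↦ expMap g.leviCivita p (t • V p)) t)
            (velocity I (fun t : ℝ ↦ expMap g.leviCivita p (t • V p)) t)) (e i t)) *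
        Matrix.of fun i k ↦ g.val (expMap g.leviCivita p (t • V p))
          (mfderiv I I (fun z ↦ expMap g.leviCivita z (t • V z)) p (w k)) (e i t))) t := by
  have hJ := fun k ↦ isJacobiFieldAlongOn_mfderiv_expMap_field g hreg hc hV p (w k)
  exact hasDerivAt_frameMatrix_of_isJacobiFieldAlongOn g
    (γ := fun t : ℝ ↦ expMap g.leviCivita p (t • V p)) (e := e) he hon hcard
    (J := fun k (t : ℝ) ↦ mfderiv I I (fun z ↦ expMap g.leviCivita z (t • V z)) p (w k))
    (fun k ↦ fun t' _ ↦ (hJ k).1 t' (mem_univ t')) (fun k t' _ ↦ (hJ k).2.1 t')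
    (fun k t' _ ↦ (hJ k).2.2.1 t') ht


/-- **Initial data `A(0) = 1`, `A₁(0) = (g(∇_{w_k} V, w_i))`** (Brendle 2023, proof of Prop. 2.5:
`P_{ij}(0) = δ_{ij}`, `P'_{ij}(0) = (D²u)(e_i, e_j)`): if the frame passes through the vectors
`w_i` at `t = 0 ∈ s` (so that `w` is `g_p`-orthonormal), then `A(0) = 1` and `A₁(0)` is the
matrix of `∇V` at `p` in the basis `w`. [cite: Brendle2022, Prop. 2.5 (proof)] -/
theorem frameMatrix_mfderiv_expMap_field_zero (hreg : g.leviCivita.IsLocallyContMDiff 1)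
    (hc : IsGeodesicallyComplete g.leviCivita)
    (hV : ContMDiff I I.tangent ∞ (fun z ↦ (TotalSpace.mk' E z (V z) : TangentBundle I M)))
    (p : M) {ι : Type*} [Fintype ι] [DecidableEq ι] {s : Set ℝ}
    {e : ι → Π t : ℝ, TangentSpace I (expMap g.leviCivita p (t • V p))}
    (hon : ∀ t ∈ s, ∀ i j, g.val (expMap g.leviCivita p (t • V p)) (e i t) (e j t) =
      if i = j then 1 else 0)
    (h0 : (0 : ℝ) ∈ s) (w : ι → TangentSpace I p) (he0 : ∀ i, e i 0 = w i) :
    (Matrix.of fun i k ↦ g.val (expMap g.leviCivita p ((0 : ℝ) • V p))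
        (mfderiv I I (fun z ↦ expMap g.leviCivita z ((0 : ℝ) • V z)) p (w k)) (e i 0)) = 1 ∧
    (Matrix.of fun i k ↦ g.val (expMap g.leviCivita p ((0 : ℝ) • V p))
        (covariantDerivAlong g.leviCivita (fun t : ℝ ↦ expMap g.leviCivita p (t • V p))
          (fun t : ℝ ↦ mfderiv I I (fun z ↦ expMap g.leviCivita z (t • V z)) p (w k)) 0) (e i 0)) =
      Matrix.of fun i k ↦ g.val p (g.leviCivita V p (w k)) (w i) := by
  have hJ := fun k ↦ isJacobiFieldAlongOn_mfderiv_expMap_field g hreg hc hV p (w k)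
  refine ⟨?_, ?_⟩
  · ext i k
    have hJ0 : mfderiv I I (fun z ↦ expMap g.leviCivita z ((0 : ℝ) • V z)) p (w k) = e k 0 :=
      (mfderiv_expMap_field_zero (cov := g.leviCivita) p (w k)).trans (he0 k).symm
    rw [Matrix.of_apply, hJ0, hon 0 h0, Matrix.one_apply]
    by_cases hik : i = k
    · subst hik; simp
    · simp [hik, Ne.symm hik]
  · -- move the base point `exp_p(0) = p`
    have aux : ∀ q : M, q = p → ∀ (X Y X' Y' : ι → E), (∀ k, X k = X' k) → (∀ i, Y i = Y' i) →
        (Matrix.of fun i k ↦ g.val q (X k) (Y i)) = Matrix.of fun i k ↦ g.val p (X' k) (Y' i) := by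
      intro q hq X Y X' Y' hX hY
      subst hq
      ext i k
      exact congrArg₂ (fun a b : E ↦ g.val q a b) (hX k) (hY i)
    have hp : expMap g.leviCivita p ((0 : ℝ) • V p) = p := by rw [zero_smul, expMap_zero]
    exact aux _ hp (fun k ↦ covariantDerivAlong g.leviCivita
      (fun t : ℝ ↦ expMap g.leviCivita p (t • V p))
      (fun t : ℝ ↦ mfderiv I I (fun z ↦ expMap g.leviCivita z (t • V z)) p (w k)) 0)
      (fun i ↦ e i 0) (fun k ↦ g.leviCivita V p (w k)) (fun i ↦ w i) (fun k ↦ (hJ k).2.2.2) he0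

omit [FiniteDimensional ℝ E] [CompleteSpace E] [T2Space M] [I.Boundaryless] [Fact (1 ≤ n)]
  [g.HasLeviCivita] [CovariantDerivative.ContMDiffCovariantDerivative g.leviCivita 1]
  [CovariantDerivative.ContMDiffCovariantDerivative g.leviCivita ∞] in
/-- **Gram matrix in an orthonormal frame**: if `v_k = ∑ᵢ A_{ik} e_i` with `e` `g_x`-orthonormal,
then `(g(v_k, v_l)) = Aᵀ A`. [folklore] -/
theorem gram_eq_transpose_mul_of_orthonormal {ι κ : Type*} [Fintype ι] [DecidableEq ι]
    (x : M) {e : ι → TangentSpace I x}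
    (hon : ∀ i j, g.val x (e i) (e j) = if i = j then 1 else 0)
    (A : Matrix ι κ ℝ) {v : κ → TangentSpace I x} (hv : ∀ k, v k = ∑ i, A i k • e i) :
    (Matrix.of fun k l ↦ g.val x (v k) (v l)) = Aᵀ * A := by
  ext k l
  simp only [Matrix.of_apply, Matrix.mul_apply, Matrix.transpose_apply, hv, map_sum, map_smul,
    FunLike.coe_sum, FunLike.coe_smul, Finset.sum_apply, Pi.smul_apply, smul_eq_mul, hon,
    mul_ite, mul_one, mul_zero, Finset.sum_ite_eq', Finset.mem_univ, if_true]
  exact Finset.sum_congr rfl fun i _ ↦ mul_comm _ _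

omit [CompleteSpace E] [T2Space M] [I.Boundaryless] [Fact (1 ≤ n)]
  [CovariantDerivative.ContMDiffCovariantDerivative g.leviCivita 1]
  [CovariantDerivative.ContMDiffCovariantDerivative g.leviCivita ∞] in
/-- **`d(Φ_t)_p(w_k) = ∑ᵢ A_{ik}(t) e_i(t)` and `det (g(dΦ_t w_k, dΦ_t w_l)) = det A(t)²`**
(Brendle 2023, proof of Prop. 2.5: "`|det DΦ_t(x̄)| = det P(t)`"): expansion in the orthonormal
frame (`eq_sum_bilin_smul_of_orthonormal`) and `gram_eq_transpose_mul_of_orthonormal`.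
[cite: Brendle2022, Prop. 2.5 (proof)] -/
theorem mfderiv_expMap_field_eq_sum_frame (p : M) {ι : Type*} [Fintype ι] [DecidableEq ι]
    {s : Set ℝ} {e : ι → Π t : ℝ, TangentSpace I (expMap g.leviCivita p (t • V p))}
    (hon : ∀ t ∈ s, ∀ i j, g.val (expMap g.leviCivita p (t • V p)) (e i t) (e j t) =
      if i = j then 1 else 0)
    (hcard : Fintype.card ι = Module.finrank ℝ E) (w : ι → TangentSpace I p) {t : ℝ}
    (ht : t ∈ s) :
    (∀ k, mfderiv I I (fun z ↦ expMap g.leviCivita z (t • V z)) p (w k) =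
      ∑ i, (Matrix.of fun i k ↦ g.val (expMap g.leviCivita p (t • V p))
        (mfderiv I I (fun z ↦ expMap g.leviCivita z (t • V z)) p (w k)) (e i t)) i k • e i t) ∧
    (Matrix.of fun k l ↦ g.val (expMap g.leviCivita p (t • V p))
        (mfderiv I I (fun z ↦ expMap g.leviCivita z (t • V z)) p (w k))
        (mfderiv I I (fun z ↦ expMap g.leviCivita z (t • V z)) p (w l))).det =
      (Matrix.of fun i k ↦ g.val (expMap g.leviCivita p (t • V p))
        (mfderiv I I (fun z ↦ expMap g.leviCivita z (t • V z)) p (w k)) (e i t)).det ^ 2 := by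
  have hexp : ∀ k, mfderiv I I (fun z ↦ expMap g.leviCivita z (t • V z)) p (w k) =
      ∑ i, (Matrix.of fun i k ↦ g.val (expMap g.leviCivita p (t • V p))
        (mfderiv I I (fun z ↦ expMap g.leviCivita z (t • V z)) p (w k)) (e i t)) i k • e i t :=
    fun k ↦ eq_sum_bilin_smul_of_orthonormal (V := E) (g.val (expMap g.leviCivita p (t • V p)))
      (hon t ht) hcard _
  refine ⟨hexp, ?_⟩
  rw [gram_eq_transpose_mul_of_orthonormal g _ (hon t ht) _ hexp, Matrix.det_mul,
    Matrix.det_transpose, sq]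

end Metric

/-! ### The gradient case: the initial derivative matrix is the Hessian -/

section Gradient

variable {E : Type*} [NormedAddCommGroup E] [NormedSpace ℝ E] [FiniteDimensional ℝ E]
  [CompleteSpace E] {H : Type*} [TopologicalSpace H] {I : ModelWithCorners ℝ E H}
  {M : Type*} [TopologicalSpace M] [ChartedSpace H M] [IsManifold I ∞ M] [I.Boundaryless]
  (g : PseudoRiemannianMetric I ∞ E (TangentSpace I : M → Type _)) [g.HasLeviCivita]

/-- **The gradient case** (Brendle 2023, proof of Prop. 2.5: `P'(0) = (D²u)(e_i, e_j)` is
symmetric and `lim tr Q = Δu(x̄)`): for `V = grad u` with `u` of class `C²` at `p` and a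
`g_p`-orthonormal basis `w`, the matrix `(g(∇_{w_k} grad u, w_i))` is the Hessian matrix
`(Hess u(w_k, w_i))` (`val_leviCivita_sharp_mvfderiv`), it is symmetric (`hessian_symm_holds`), and
its trace is `Δ_g u (p) = tr_g Hess u` (`trace_eq_sum_bilin_of_orthonormal`).
[cite: Brendle2022, Prop. 2.5 (proof)] -/
theorem frameMatrix_leviCivita_grad {u : M → ℝ} {p : M} (hu : CMDiffAt 2 u p)
    {ι : Type*} [Fintype ι] [DecidableEq ι] (w : ι → TangentSpace I p)
    (hw : ∀ i j, g.val p (w i) (w j) = if i = j then 1 else 0)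
    (hcard : Fintype.card ι = Module.finrank ℝ E) :
    (Matrix.of fun i k ↦ g.val p (g.leviCivita (grad g u) p (w k)) (w i)) =
        (Matrix.of fun i k ↦ g.hessian u p (w k) (w i)) ∧
      (Matrix.of fun i k ↦ g.val p (g.leviCivita (grad g u) p (w k)) (w i)).IsSymm ∧
      (Matrix.of fun i k ↦ g.val p (g.leviCivita (grad g u) p (w k)) (w i)).trace =
        g.dalembertian u p := by
  have h1 : ∀ v v' : TangentSpace I p, g.val p (g.leviCivita (grad g u) p v) v' =
      g.hessian u p v v' := fun v v' ↦
    PseudoRiemannianMetric.val_leviCivita_sharp_mvfderiv (g := g) hu v v'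
  have hmat : (Matrix.of fun i k ↦ g.val p (g.leviCivita (grad g u) p (w k)) (w i)) =
      Matrix.of fun i k ↦ g.hessian u p (w k) (w i) := by
    ext i k
    simp only [Matrix.of_apply, h1]
  have hsymm := PseudoRiemannianMetric.hessian_symm_holds (g := g) hu
  refine ⟨hmat, ?_, ?_⟩
  · rw [hmat]
    ext i k
    simp only [Matrix.transpose_apply, Matrix.of_apply]
    exact hsymm.eq (w i) (w k)
  · rw [hmat]
    simp only [Matrix.trace, Matrix.diag_apply, Matrix.of_apply]
    have h := trace_eq_sum_bilin_of_orthonormal (V := E) (g.val p) hw hcard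
      ((g.sharp p).toLinearMap ∘ₗ g.hessian u p)
    refine (h.trans (Finset.sum_congr rfl fun a _ ↦ ?_)).symm
    rw [LinearMap.comp_apply]
    exact g.val_sharp_apply p (g.hessian u p (w a)) (w a)

end Gradient

end Literature.Geometry.Riemannian
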